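import Mathlib.Order.PiLex
import Literature.Analysis.FluidPDE.StokesTorusDomainProofs
import Literature.Analysis.FluidPDE.NSHopfLimit
import Literature.Analysis.FunctionSpaces.TorusVectorParseval
import Literature.Analysis.FunctionSpaces.TorusSobolevNormFacts
import Summits.AnomalousDissipation.AnomalousDissipation.Theorems.SolenoidalFractalHomogenisationRealisedQuasiStaticCellLawSectorReduction
import HarnessLib

/-!
# K2R `RealisedQuasiStaticCellLaw`, line `floquet-bloch`: the registered stub `stub_sectorPieces`
# (Bloch-sector decomposition of an `H¹` divergence-free mean-zero datum on `T³`)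

Summits-side stub proof (everything proved; no definitions, no named facts; `--supports stmt-AnomalousDissipation-20446`,
registered stub `stub_sectorPieces` of skeleton r14, BY NAME and verbatim signature).

For a cell number `n ≥ 1`, every `H¹` weakly divergence-free mean-zero real vector field `w₀ : T³ → ℝ³` is a finite sum
`w₀ = ∑_{ℓ ∈ ι} v ℓ` of `H¹` weakly divergence-free mean-zero fields, `v ℓ` being Fourier-supported in the symmetric
Bloch sector `{k | k ≡ ℓ ∨ k ≡ −ℓ (mod n) componentwise}` and the sectors of `ι` being pairwise disjoint.

Construction. `res k = (kᵢ mod n)ᵢ ∈ [0,n)³`; the CLASS of `k` is the unordered pair `{res k, res (−k)}` and its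
representative `σ k` the lexicographic minimum of the pair; `ι` = the representatives in `[0,n)³`. The piece of class `r`
has coefficients `1[σ k = r]·ŵ₀(k)` — conjugate symmetric (`σ(−k) = σ k`, `ŵ₀(−k) = conj ŵ₀(k)`) and square summable, hence
the coefficient family of a real `L²` field (`Torus.exists_forall_mFourierCoeff_eq_of_isConjSymm`, Riesz–Fischer); the
piece of the class of `0` is re-defined as `w₀ −` (the others) so that the sum is `w₀` POINTWISE (same coefficients). Every
property is then read off the coefficients: `H¹` (termwise domination of the Sobolev series), weak divergence-freeness
(transversality `k · v̂(k) = 0`, `Torus.isWeaklyDivFree_of_sum_mul_mFourierCoeff_eq_zero` /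
`IsWeaklyDivFree.sum_mul_mFourierCoeff_eq_zero`), zero mean (`v̂(0) = 0`), sector support, and disjointness of the sectors
of distinct representatives.
-/

set_option linter.dupNamespace false

noncomputable section

namespace Summit.AnomalousDissipation.AnomalousDissipation.Theorems.SolenoidalFractalHomogenisation.RealisedQuasiStaticCellLaw

open Set MeasureTheory Filter
open scoped InnerProductSpace
open Literature.Analysis Literature.Analysis.FunctionSpaces Literature.Analysis.FluidPDE

/-! ### Residues modulo `n` on `ℤ³` -/

/-- `k = res k + n • (k / n)` componentwise (Euclidean division). -/
theorem eq_emod_add_zsmul_ediv (n : ℕ) (k : Fin 3 → ℤ) :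
    k = (fun i => k i % (n:ℤ)) + (n:ℤ) • (fun i => k i / (n:ℤ)) := by
  funext i
  simp only [Pi.add_apply, Pi.smul_apply, smul_eq_mul]
  exact (Int.emod_add_mul_ediv (k i) n).symm

/-- The residue of `ℓ + n • z` is the residue of `ℓ`. -/
theorem emod_add_zsmul (n : ℕ) (ℓ z : Fin 3 → ℤ) :
    (fun i => (ℓ + (n:ℤ) • z) i % (n:ℤ)) = fun i => ℓ i % (n:ℤ) := by
  funext i
  simp only [Pi.add_apply, Pi.smul_apply, smul_eq_mul]
  exact Int.add_mul_emod_self_left _ _ _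

/-- The residue map is idempotent. -/
theorem emod_emod_fun (n : ℕ) (k : Fin 3 → ℤ) :
    (fun i => (fun j => k j % (n:ℤ)) i % (n:ℤ)) = fun i => k i % (n:ℤ) := by
  funext i
  exact Int.emod_emod_of_dvd _ (dvd_refl _)

/-- `res (−res k) = res (−k)`. -/
theorem emod_neg_emod_fun (n : ℕ) (k : Fin 3 → ℤ) :
    (fun i => (-(fun j => k j % (n:ℤ))) i % (n:ℤ)) = fun i => (-k) i % (n:ℤ) := by
  funext i
  simp only [Pi.neg_apply]
  exact (Int.mod_modEq (k i) (n:ℤ)).neg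

/-! ### Fourier-side helpers -/

/-- Fourier coefficients of a finite sum of integrable functions. -/
theorem mFourierCoeff_finset_sum {ι' : Type*} (s : Finset ι')
    {F : Type*} [NormedAddCommGroup F] [NormedSpace ℂ F] [CompleteSpace F]
    (f : ι' → UnitAddTorus (Fin 3) → F) (hf : ∀ i ∈ s, Integrable (f i) volume) (k : Fin 3 → ℤ) :
    UnitAddTorus.mFourierCoeff (fun x => ∑ i ∈ s, f i x) k = ∑ i ∈ s, UnitAddTorus.mFourierCoeff (f i) k := by
  classical
  induction s using Finset.induction_on with
  | empty =>
    simp only [Finset.sum_empty]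
    rw [FunctionSpaces.Torus.mFourierCoeff_eq_integral_volume]
    simp
  | insert a s ha ih =>
    have hf' : ∀ i ∈ s, Integrable (f i) volume := fun i hi => hf i (Finset.mem_insert_of_mem hi)
    simp only [Finset.sum_insert ha]
    have e : (fun x => f a x + ∑ i ∈ s, f i x) = f a + fun x => ∑ i ∈ s, f i x := by funext x; simp
    rw [e, FunctionSpaces.Torus.mFourierCoeff_add (hf a (Finset.mem_insert_self a s))
      (integrable_finsetSum s hf'), ih hf']

/-- The zeroth Fourier coefficient of a complexified real field is the complexified mean. -/
theorem mFourierCoeff_complexify_zero_eq_mean {w : UnitAddTorus (Fin 3) → EuclideanSpace ℝ (Fin 3)}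
    (hw : Integrable w volume) :
    UnitAddTorus.mFourierCoeff (FunctionSpaces.EuclideanSpace.complexify ∘ w) 0 =
      FunctionSpaces.EuclideanSpace.complexify (∫ x, w x) := by
  rw [FunctionSpaces.Torus.mFourierCoeff_eq_integral_volume]
  have h1 : (fun x : UnitAddTorus (Fin 3) =>
      UnitAddTorus.mFourier (-(0 : Fin 3 → ℤ)) x • (FunctionSpaces.EuclideanSpace.complexify ∘ w) x) =
      fun x => FunctionSpaces.EuclideanSpace.complexify.toContinuousLinearMap (w x) := by
    funext x
    rw [neg_zero, Function.comp_apply, UnitAddTorus.mFourier_zero]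
    simp
  rw [h1, ContinuousLinearMap.integral_comp_comm _ hw]
  rfl

/-- The Sobolev norm is monotone in the moduli of the Fourier coefficients. -/
theorem eSobolevNorm_mono_of_norm_mFourierCoeff_le {F : Type*} [NormedAddCommGroup F] [NormedSpace ℂ F]
    [CompleteSpace F] (s : ℝ) {f g : UnitAddTorus (Fin 3) → F}
    (h : ∀ k, ‖UnitAddTorus.mFourierCoeff g k‖ ≤ ‖UnitAddTorus.mFourierCoeff f k‖) :
    FunctionSpaces.Torus.eSobolevNorm s g ≤ FunctionSpaces.Torus.eSobolevNorm s f := by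
  unfold FunctionSpaces.Torus.eSobolevNorm
  refine ENNReal.rpow_le_rpow (ENNReal.tsum_le_tsum fun k => ?_) (by norm_num)
  gcongr
  rw [← ofReal_norm, ← ofReal_norm]
  exact ENNReal.ofReal_le_ofReal (h k)

/-- All four datum properties of a piece, read off its Fourier coefficients: if `v ∈ L²(T³; ℝ³)` has coefficients
`𝓕(complexify ∘ v)(k) = 1[P k]·𝓕(complexify ∘ w₀)(k)` for an `H¹` weakly divergence-free mean-zero `w₀`, then `v` is
`H¹`, weakly divergence free and mean zero. -/
theorem piece_props {w₀ v : UnitAddTorus (Fin 3) → EuclideanSpace ℝ (Fin 3)}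
    (hw₀ : FunctionSpaces.Torus.MemSobolev 1 (FunctionSpaces.EuclideanSpace.complexify ∘ w₀))
    (hdiv : FunctionSpaces.Torus.IsWeaklyDivFree w₀) (hmean : FunctionSpaces.Torus.HasZeroMean w₀)
    (hv : MemLp v 2 volume) (P : (Fin 3 → ℤ) → Prop) [DecidablePred P]
    (hcoef : ∀ k, UnitAddTorus.mFourierCoeff (FunctionSpaces.EuclideanSpace.complexify ∘ v) k =
      if P k then UnitAddTorus.mFourierCoeff (FunctionSpaces.EuclideanSpace.complexify ∘ w₀) k else 0) :
    FunctionSpaces.Torus.MemSobolev 1 (FunctionSpaces.EuclideanSpace.complexify ∘ v) ∧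
      FunctionSpaces.Torus.IsWeaklyDivFree v ∧ FunctionSpaces.Torus.HasZeroMean v := by
  have hw2 : MemLp w₀ 2 volume := memLp_two_of_memSobolev_one_complexify hw₀
  have hwi : Integrable w₀ volume := hw2.integrable one_le_two
  have hvi : Integrable v volume := hv.integrable one_le_two
  refine ⟨⟨FunctionSpaces.Torus.integrable_complexify_comp hvi, ?_⟩, ?_, ?_⟩
  · -- `H¹`: termwise domination
    refine lt_of_le_of_lt (eSobolevNorm_mono_of_norm_mFourierCoeff_le 1 fun k => ?_) hw₀.2
    rw [hcoef k]
    split_ifs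
    · exact le_rfl
    · rw [norm_zero]; exact norm_nonneg _
  · -- weakly divergence free: transversality of the coefficients
    refine Torus.isWeaklyDivFree_of_sum_mul_mFourierCoeff_eq_zero hv fun k => ?_
    rw [hcoef k]
    split_ifs
    · exact FunctionSpaces.Torus.IsWeaklyDivFree.sum_mul_mFourierCoeff_eq_zero hw2 hdiv k
    · simp
  · -- mean zero: the zeroth coefficient vanishes
    have h0 : UnitAddTorus.mFourierCoeff (FunctionSpaces.EuclideanSpace.complexify ∘ v) 0 = 0 := by
      rw [hcoef 0]
      split_ifs
      · rw [mFourierCoeff_complexify_zero_eq_mean hwi]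
        rw [show (∫ x, w₀ x) = 0 from hmean, map_zero]
      · rfl
    rw [mFourierCoeff_complexify_zero_eq_mean hvi] at h0
    have : (∫ x, v x) = 0 := FunctionSpaces.EuclideanSpace.complexify_injective (by rw [h0, map_zero])
    exact this

/-! ### The registered stub -/

/-- **stub_sectorPieces** (S0 of skeleton r14 of line `floquet-bloch`, crux `RealisedQuasiStaticCellLaw`,
stmt-AnomalousDissipation-20446; Bloch decomposition of the datum). For `n ≥ 1`, every `H¹` weakly divergence-free
mean-zero real vector field on `T³` is a finite sum of `H¹` weakly divergence-free mean-zero fields, each Fourier-supported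
in one symmetric Bloch sector `{k | k ≡ ℓ ∨ k ≡ −ℓ (mod n)}`, the sectors used being pairwise disjoint. -/
theorem stub_sectorPieces : ∀ n : ℕ, 0 < n → ∀ w₀ : UnitAddTorus (Fin 3) → EuclideanSpace ℝ (Fin 3),
    FunctionSpaces.Torus.MemSobolev 1 (FunctionSpaces.EuclideanSpace.complexify ∘ w₀) →
    FunctionSpaces.Torus.IsWeaklyDivFree w₀ → FunctionSpaces.Torus.HasZeroMean w₀ →
    ∃ ι : Finset (Fin 3 → ℤ), ∃ v : (Fin 3 → ℤ) → UnitAddTorus (Fin 3) → EuclideanSpace ℝ (Fin 3),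
      (∀ ℓ ∈ ι, FunctionSpaces.Torus.MemSobolev 1 (FunctionSpaces.EuclideanSpace.complexify ∘ v ℓ) ∧
        FunctionSpaces.Torus.IsWeaklyDivFree (v ℓ) ∧ FunctionSpaces.Torus.HasZeroMean (v ℓ) ∧
        ∀ k : Fin 3 → ℤ, ¬ ((∃ z : Fin 3 → ℤ, k = ℓ + (n:ℤ) • z) ∨ (∃ z : Fin 3 → ℤ, k = -ℓ + (n:ℤ) • z)) →
          UnitAddTorus.mFourierCoeff (FunctionSpaces.EuclideanSpace.complexify ∘ v ℓ) k = 0) ∧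
      (∀ ℓ ∈ ι, ∀ ℓ' ∈ ι, ℓ ≠ ℓ' → ∀ k : Fin 3 → ℤ,
        ((∃ z : Fin 3 → ℤ, k = ℓ + (n:ℤ) • z) ∨ (∃ z : Fin 3 → ℤ, k = -ℓ + (n:ℤ) • z)) →
        ¬ ((∃ z : Fin 3 → ℤ, k = ℓ' + (n:ℤ) • z) ∨ (∃ z : Fin 3 → ℤ, k = -ℓ' + (n:ℤ) • z))) ∧
      w₀ = fun x => ∑ ℓ ∈ ι, v ℓ x := by
  intro n hn w₀ hw₀ hdiv hmean
  classical
  -- residues and class representatives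
  set res : (Fin 3 → ℤ) → (Fin 3 → ℤ) := fun k i => k i % (n:ℤ) with hres
  set σ : (Fin 3 → ℤ) → (Fin 3 → ℤ) := fun k => ofLex (min (toLex (res k)) (toLex (res (-k)))) with hσ
  have hn' : (0:ℤ) < n := by exact_mod_cast hn
  -- basic residue facts
  have res_decomp : ∀ k, k = res k + (n:ℤ) • (fun i => k i / (n:ℤ)) := fun k => eq_emod_add_zsmul_ediv n k
  have res_vadd : ∀ ℓ z, res (ℓ + (n:ℤ) • z) = res ℓ := fun ℓ z => emod_add_zsmul n ℓ z
  have res_res : ∀ k, res (res k) = res k := fun k => emod_emod_fun n k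
  have res_neg_res : ∀ k, res (-res k) = res (-k) := fun k => emod_neg_emod_fun n k
  have res_range : ∀ k i, 0 ≤ res k i ∧ res k i < n := fun k i =>
    ⟨Int.emod_nonneg _ hn'.ne', Int.emod_lt_of_pos _ hn'⟩
  -- facts about the representative `σ`
  have σ_choice : ∀ k, σ k = res k ∨ σ k = res (-k) := by
    intro k
    rcases min_choice (toLex (res k)) (toLex (res (-k))) with h | h
    · left; simp only [hσ, h, ofLex_toLex]
    · right; simp only [hσ, h, ofLex_toLex]
  have σ_neg : ∀ k, σ (-k) = σ k := by
    intro k; simp only [hσ, neg_neg, min_comm]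
  have σ_range : ∀ k i, 0 ≤ σ k i ∧ σ k i < n := by
    intro k i
    rcases σ_choice k with h | h <;> rw [h] <;> exact res_range _ i
  -- membership of `k` in the sector of `σ k`
  have σ_mem : ∀ k, (∃ z : Fin 3 → ℤ, k = σ k + (n:ℤ) • z) ∨ (∃ z : Fin 3 → ℤ, k = -σ k + (n:ℤ) • z) := by
    intro k
    rcases σ_choice k with h | h
    · left; exact ⟨fun i => k i / (n:ℤ), by rw [h]; exact res_decomp k⟩
    · right
      refine ⟨fun i => -((-k) i / (n:ℤ)), ?_⟩
      rw [h]
      funext i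
      have ei := congrFun (res_decomp (-k)) i
      simp only [Pi.neg_apply, Pi.add_apply, Pi.smul_apply, smul_eq_mul] at ei ⊢
      linarith
  -- `σ` depends only on the class: members of the sector of `σ k₁`-type representatives
  have σ_of_mem : ∀ r k, σ r = r →
      ((∃ z : Fin 3 → ℤ, k = r + (n:ℤ) • z) ∨ (∃ z : Fin 3 → ℤ, k = -r + (n:ℤ) • z)) → σ k = r := by
    intro r k hr hk
    -- the unordered pairs `{res k, res (-k)}` and `{res r, res (-r)}` coincide
    have hpair : (res k = res r ∧ res (-k) = res (-r)) ∨ (res k = res (-r) ∧ res (-k) = res r) := by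
      rcases hk with ⟨z, hz⟩ | ⟨z, hz⟩
      · left
        refine ⟨by rw [hz, res_vadd], ?_⟩
        have : -k = -r + (n:ℤ) • (-z) := by rw [hz]; funext i; simp; ring
        rw [this, res_vadd]
      · right
        refine ⟨by rw [hz, res_vadd], ?_⟩
        have : -k = r + (n:ℤ) • (-z) := by rw [hz]; funext i; simp; ring
        rw [this, res_vadd]
    have hσr : σ r = ofLex (min (toLex (res r)) (toLex (res (-r)))) := rfl
    have hσk : σ k = ofLex (min (toLex (res k)) (toLex (res (-k)))) := rfl
    rcases hpair with ⟨h1, h2⟩ | ⟨h1, h2⟩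
    · rw [hσk, h1, h2, ← hσr, hr]
    · rw [hσk, h1, h2, min_comm, ← hσr, hr]
  have σ_σ : ∀ k, σ (σ k) = σ k := by
    intro k
    have hσk : σ k = ofLex (min (toLex (res k)) (toLex (res (-k)))) := rfl
    have hσσ : σ (σ k) = ofLex (min (toLex (res (σ k))) (toLex (res (-(σ k))))) := rfl
    rcases σ_choice k with h | h
    · rw [hσσ, h, res_res, res_neg_res]; exact h
    · rw [hσσ, h, res_res, res_neg_res, neg_neg, min_comm]; exact h
  -- the index set: representatives in `[0,n)³`
  set box : Finset (Fin 3 → ℤ) := (Finset.univ : Finset (Fin 3 → Fin n)).image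
    (fun r i => ((r i : ℕ) : ℤ)) with hbox
  set ι : Finset (Fin 3 → ℤ) := box.filter (fun r => σ r = r) with hι
  have mem_box : ∀ k : Fin 3 → ℤ, (∀ i, 0 ≤ k i ∧ k i < n) → k ∈ box := by
    intro k hk
    rw [hbox, Finset.mem_image]
    refine ⟨fun i => ⟨(k i).toNat, by have h1 := (hk i).1; have h2 := (hk i).2; omega⟩, Finset.mem_univ _, ?_⟩
    funext i
    show (((k i).toNat : ℕ) : ℤ) = k i
    exact Int.toNat_of_nonneg (hk i).1
  have σ_mem_ι : ∀ k, σ k ∈ ι := by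
    intro k
    rw [hι, Finset.mem_filter]
    exact ⟨mem_box _ (σ_range k), σ_σ k⟩
  have ι_fixed : ∀ r ∈ ι, σ r = r := fun r hr => (Finset.mem_filter.1 hr).2
  -- the coefficients of the pieces
  set a : (Fin 3 → ℤ) → EuclideanSpace ℂ (Fin 3) :=
    fun k => UnitAddTorus.mFourierCoeff (FunctionSpaces.EuclideanSpace.complexify ∘ w₀) k with ha
  have hw2 : MemLp w₀ 2 volume := memLp_two_of_memSobolev_one_complexify hw₀
  have hwi : Integrable w₀ volume := hw2.integrable one_le_two
  have ha_symm : FunctionSpaces.Torus.IsConjSymm a := FunctionSpaces.Torus.isConjSymm_mFourierCoeff hwi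
  have ha_sum : Summable fun k => ‖a k‖ ^ 2 :=
    (FunctionSpaces.Torus.hasSum_sq_norm_mFourierCoeff_complexify hw2).summable
  set b : (Fin 3 → ℤ) → (Fin 3 → ℤ) → EuclideanSpace ℂ (Fin 3) :=
    fun r k => if σ k = r then a k else 0 with hb
  have hb_symm : ∀ r, FunctionSpaces.Torus.IsConjSymm (b r) := by
    intro r k
    simp only [hb, σ_neg]
    split_ifs with h
    · exact ha_symm k
    · exact (FunctionSpaces.EuclideanSpace.conjVec_zero).symm
  have hb_norm : ∀ r k, ‖b r k‖ ≤ ‖a k‖ := by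
    intro r k
    simp only [hb]
    split_ifs
    · exact le_rfl
    · rw [norm_zero]; exact norm_nonneg _
  have hb_sum : ∀ r, Summable fun k => ‖b r k‖ ^ 2 := fun r =>
    ha_sum.of_nonneg_of_le (fun k => sq_nonneg _) fun k =>
      pow_le_pow_left₀ (norm_nonneg _) (hb_norm r k) 2
  -- Riesz–Fischer, real form: one `L²` real field per class
  have hRF : ∀ r, ∃ W : Lp (EuclideanSpace ℝ (Fin 3)) 2 (volume : Measure (UnitAddTorus (Fin 3))),
      ∀ k, UnitAddTorus.mFourierCoeff (FunctionSpaces.EuclideanSpace.complexify ∘ ⇑W) k = b r k :=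
    fun r => Torus.exists_forall_mFourierCoeff_eq_of_isConjSymm (hb_symm r) (hb_sum r)
  choose W hW using hRF
  -- the pieces: the class of `0` absorbs the remainder so that the sum is `w₀` pointwise
  set r₀ := σ 0 with hr₀
  have hr₀ι : r₀ ∈ ι := σ_mem_ι 0
  set v : (Fin 3 → ℤ) → UnitAddTorus (Fin 3) → EuclideanSpace ℝ (Fin 3) :=
    fun r => if r = r₀ then (fun x => w₀ x - ∑ r' ∈ ι.erase r₀, (W r' : UnitAddTorus (Fin 3) → _) x)
      else (W r : UnitAddTorus (Fin 3) → _) with hv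
  have v_ne : ∀ r, r ≠ r₀ → v r = (W r : UnitAddTorus (Fin 3) → EuclideanSpace ℝ (Fin 3)) := by
    intro r hr; simp only [hv, if_neg hr]
  have v_r₀ : v r₀ = fun x => w₀ x - ∑ r' ∈ ι.erase r₀, (W r' : UnitAddTorus (Fin 3) → _) x := by
    simp only [hv, if_pos rfl]
  have hWL2 : ∀ r, MemLp (W r : UnitAddTorus (Fin 3) → EuclideanSpace ℝ (Fin 3)) 2 volume := fun r => Lp.memLp (W r)
  have hWi : ∀ r, Integrable (W r : UnitAddTorus (Fin 3) → EuclideanSpace ℝ (Fin 3)) volume :=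
    fun r => (hWL2 r).integrable one_le_two
  -- (i) every piece is `L²`
  have hvL2 : ∀ r, MemLp (v r) 2 volume := by
    intro r
    by_cases hr : r = r₀
    · rw [hr, v_r₀]
      exact hw2.sub (memLp_finsetSum (ι.erase r₀) fun r' _ => hWL2 r')
    · rw [v_ne r hr]; exact hWL2 r
  -- (ii) the coefficients of every piece
  have hvcoef : ∀ r ∈ ι, ∀ k, UnitAddTorus.mFourierCoeff (FunctionSpaces.EuclideanSpace.complexify ∘ v r) k = b r k := by
    intro r hr k
    by_cases hrr : r = r₀
    · subst hrr
      rw [v_r₀]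
      have e : (FunctionSpaces.EuclideanSpace.complexify ∘ fun x =>
          w₀ x - ∑ r' ∈ ι.erase (σ 0), (W r' : UnitAddTorus (Fin 3) → _) x) =
          (FunctionSpaces.EuclideanSpace.complexify ∘ w₀) +
            fun x => ∑ r' ∈ ι.erase (σ 0), (-(FunctionSpaces.EuclideanSpace.complexify ∘ (W r' : UnitAddTorus (Fin 3) → _))) x := by
        funext x
        simp only [Function.comp_apply, Pi.add_apply, Pi.neg_apply]
        rw [map_sub, map_sum, Finset.sum_neg_distrib, sub_eq_add_neg]
      rw [e, FunctionSpaces.Torus.mFourierCoeff_add (FunctionSpaces.Torus.integrable_complexify_comp hwi)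
        (integrable_finsetSum _ fun r' _ => (FunctionSpaces.Torus.integrable_complexify_comp (hWi r')).neg),
        mFourierCoeff_finset_sum _ _ (fun r' _ => (FunctionSpaces.Torus.integrable_complexify_comp (hWi r')).neg)]
      have eneg : ∀ r', UnitAddTorus.mFourierCoeff (-(FunctionSpaces.EuclideanSpace.complexify ∘
          (W r' : UnitAddTorus (Fin 3) → EuclideanSpace ℝ (Fin 3)))) k = -b r' k := by
        intro r'
        rw [FunctionSpaces.Torus.mFourierCoeff_neg, hW r' k]
      simp only [eneg, Finset.sum_neg_distrib]
      -- `∑_{r' ∈ ι ∖ {r₀}} b r' k = 1[σ k ≠ r₀] a k`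
      have hsum : ∑ r' ∈ ι.erase (σ 0), b r' k = if σ k = σ 0 then 0 else a k := by
        simp only [hb]
        rw [Finset.sum_ite_eq (ι.erase (σ 0)) (σ k) (fun _ => a k)]
        by_cases h : σ k = σ 0
        · simp [h]
        · rw [if_pos (Finset.mem_erase.2 ⟨h, σ_mem_ι k⟩), if_neg h]
      rw [hsum]
      simp only [hb]
      split_ifs <;> simp [ha]
    · rw [v_ne r hrr]; exact hW r k
  -- (iii) the sum is `w₀` pointwise
  have hsum : w₀ = fun x => ∑ r ∈ ι, v r x := by
    funext x
    rw [← Finset.add_sum_erase ι (fun r => v r x) hr₀ι, v_r₀]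
    have : ∑ r ∈ ι.erase r₀, v r x = ∑ r ∈ ι.erase r₀, (W r : UnitAddTorus (Fin 3) → EuclideanSpace ℝ (Fin 3)) x :=
      Finset.sum_congr rfl fun r hr => by rw [v_ne r (Finset.ne_of_mem_erase hr)]
    rw [this]
    simp
  refine ⟨ι, v, fun r hr => ?_, fun r hr r' hr' hne k hk hk' => ?_, hsum⟩
  · -- the four properties of the piece `v r`
    obtain ⟨hH1, hdv, hmv⟩ := piece_props hw₀ hdiv hmean (hvL2 r) (fun k => σ k = r)
      (fun k => by rw [hvcoef r hr k])
    refine ⟨hH1, hdv, hmv, fun k hk => ?_⟩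
    rw [hvcoef r hr k]
    simp only [hb]
    rw [if_neg]
    intro hσk
    exact hk (hσk ▸ σ_mem k)
  · -- disjointness of the sectors of distinct representatives
    have h1 := σ_of_mem r k (ι_fixed r hr) hk
    have h2 := σ_of_mem r' k (ι_fixed r' hr') hk'
    exact hne (h1.symm.trans h2)

end Summit.AnomalousDissipation.AnomalousDissipation.Theorems.SolenoidalFractalHomogenisation.RealisedQuasiStaticCellLaw

end
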